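import Mathlib
import Summits.Ventures.PercRepro2.A3CutOBehind

/-!
# A mark behind a cut vertex `y` of the explored vertex `x ≠ y`: the fibre masses across the cut
(blind cell PercRepro2, night-1 g33; proofs/NIGHT1-G33.md §8; census mining/night-1/g33/check_mark_pull.py
186/186)

Setting: `y` a cut vertex (`IsCut ends y ↑VA ↑VB EA EB`), the explored vertex `x` and the roots `a₁, a₂`
on the side `VB ∪ {y}`, a mark `m ∈ VA` behind `y`.  For `u ∈ VB ∪ {y}` the connection event `{u ↔ m}`
is `{u ↔ y}_B ∩ {y ↔ m}_A` (`connEvent_eq_inter_sideEvent`), so for every `B`-side event `Y`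
`P(Y, u ↔ m) = P(Y, u ↔ y) · P(y ↔ m)` (`prob_inter_conn_pull`): the mark `m` pulls back to `y` with
the factor `P(y ↔ m)` on `Q` (`mU_pull`) and on `PD` (`Do_pull`, `gamma_pull`, `gamma0_pull`).  On a
fibre `W ∌ y` of the `x`-exploration — a `B`-side event (`fibre_eq_sideEventB_of_notMem`) — the masses
of `m` are `P(y ↔ m)` times those of `y` (`Ssig_pull_notMem`, `Su_pull_notMem`); on a fibre `W ∋ y`
the event `{u ↔ m}` is the constant `[u ∈ W ∧ m ∈ W]` (`fibre_inter_conn_of_mem`) and `{u ↔ y}` is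
`[u ∈ W]` (`fibre_inter_conn_y_of_mem`).  Standard axioms.
-/

namespace Summit.Ventures.PercRepro2

open UnionCluster CovForm CutV

namespace CovForm

namespace A3Fibre

namespace MarkPull

section Sets

variable {V : Type*} {E : Type*} [DecidableEq V] {ends : E → Sym2 V} {y : V} {VA VB : Finset V}
  {EA EB : Set E} [DecidablePred (· ∈ EA)] [DecidablePred (· ∈ EB)] {x a₁ a₂ : V}

/-- For `u ∈ VB ∪ {y}` and `m ∈ VA`, `{u ↔ m} = {u ↔ y}_B ∩ {y ↔ m}_A`. -/
lemma connEvent_eq_inter_sideEvent (h : IsCut ends y ↑VA ↑VB EA EB) {u m : V}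
    (hu : u ∈ insert y VB) (hm : m ∈ VA) :
    connEvent ends u m = sideEvent EB (connEvent ends u y) ∩ sideEvent EA (connEvent ends y m) := by
  rcases Finset.mem_insert.1 hu with huy | huB
  · rw [huy]
    have e1 : connEvent ends y m = sideEvent EA (connEvent ends y m) :=
      connEvent_eq_sideEvent h (Or.inr rfl) (Or.inl (Finset.mem_coe.2 hm))
    have e2 : sideEvent EB (connEvent ends y y) = Set.univ := by
      ext ω
      simp only [mem_sideEvent, mem_connEvent, Set.mem_univ, iff_true]
      exact conn_refl _ _ _
    rw [e2, Set.univ_inter]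
    exact e1
  · exact connEvent_across_eq h.symm (Finset.mem_coe.2 huB) (Finset.mem_coe.2 hm)

/-- A fibre of the `x`-exploration not containing the cut vertex `y` is a `B`-side event. -/
lemma fibre_eq_sideEventB_of_notMem (h : IsCut ends y ↑VA ↑VB EA EB) (hx : x ∈ insert y VB)
    (h1 : a₁ ∈ insert y VB) (h2 : a₂ ∈ insert y VB) {W : Finset V} (hW : y ∉ W) :
    fibre ends a₁ a₂ x W = sideEvent EB (fibre ends a₁ a₂ x W) := by
  unfold fibre
  rw [← sideEvent_inter, ← avoidAll_eq_sideEventB' h h1 h2]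
  congr 1
  ext ω
  simp only [mem_sideEvent, mem_clusterEvent]
  rcases Finset.mem_insert.1 hx with hxy | hxB
  · rw [hxy]
    have hy : ∀ ω' : Config E, cluster ends ω' y ≠ ↑W := fun ω' hc =>
      hW (Finset.mem_coe.1 (by rw [← hc]; exact mem_cluster_self ends ω' y))
    exact ⟨fun hc => absurd hc (hy ω), fun hc => absurd hc (hy _)⟩
  · constructor
    · intro hc
      have hny : ¬ Conn ends (restrict EB ω) x y := fun hc' =>
        hW (Finset.mem_coe.1 (by rw [← hc]; exact conn_mono (restrict_le EB ω) hc'))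
      rw [← cluster_eq_of_not_conn h.symm (Finset.mem_coe.2 hxB) hny]
      exact hc
    · intro hc
      have hny : ¬ Conn ends (restrict EB ω) x y := fun hc' =>
        hW (Finset.mem_coe.1 (by rw [← hc]; exact hc'))
      rw [cluster_eq_of_not_conn h.symm (Finset.mem_coe.2 hxB) hny]
      exact hc

/-- On a fibre `W ∋ y`, for `u ∈ VB ∪ {y}` and `m ∈ VA`, `{u ↔ m}` is the constant
`[u ∈ W ∧ m ∈ W]`. -/
lemma fibre_inter_conn_of_mem (h : IsCut ends y ↑VA ↑VB EA EB) {u m : V} (hu : u ∈ insert y VB)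
    (hm : m ∈ VA) {W : Finset V} (hW : y ∈ W) :
    fibre ends a₁ a₂ x W ∩ connEvent ends u m =
      if u ∈ W ∧ m ∈ W then fibre ends a₁ a₂ x W else ∅ := by
  ext ω
  constructor
  · rintro ⟨hω, hum⟩
    have hxy : Conn ends ω x y := by
      have : y ∈ cluster ends ω x := by rw [hω.2]; exact Finset.mem_coe.2 hW
      exact this
    have hum' : Conn ends ω u y ∧ Conn ends ω y m := by
      rcases Finset.mem_insert.1 hu with huy | huB
      · rw [huy] at hum ⊢
        exact ⟨conn_refl _ _ _, hum⟩
      · obtain ⟨c1, c2⟩ :=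
          (conn_across_iff h.symm (Finset.mem_coe.2 huB) (Finset.mem_coe.2 hm)).1 hum
        exact ⟨conn_mono (restrict_le EB ω) c1, conn_mono (restrict_le EA ω) c2⟩
    have hu' : u ∈ W := by
      have : u ∈ cluster ends ω x := conn_trans hxy (conn_symm hum'.1)
      rw [hω.2] at this
      exact Finset.mem_coe.1 this
    have hm' : m ∈ W := by
      have : m ∈ cluster ends ω x := conn_trans hxy hum'.2
      rw [hω.2] at this
      exact Finset.mem_coe.1 this
    rw [if_pos ⟨hu', hm'⟩]
    exact hω
  · intro hω
    by_cases hc : u ∈ W ∧ m ∈ W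
    · rw [if_pos hc] at hω
      refine ⟨hω, ?_⟩
      have hxu : Conn ends ω x u := by
        have : u ∈ cluster ends ω x := by rw [hω.2]; exact Finset.mem_coe.2 hc.1
        exact this
      have hxm : Conn ends ω x m := by
        have : m ∈ cluster ends ω x := by rw [hω.2]; exact Finset.mem_coe.2 hc.2
        exact this
      exact conn_trans (conn_symm hxu) hxm
    · rw [if_neg hc] at hω
      exact absurd hω (Set.notMem_empty ω)

omit [DecidablePred (· ∈ EA)] [DecidablePred (· ∈ EB)] in
/-- On a fibre `W ∋ y`, `{u ↔ y}` is the constant `[u ∈ W]` (no cut needed). -/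
lemma fibre_inter_conn_y_of_mem {W : Finset V} (hW : y ∈ W) (u : V) :
    fibre ends a₁ a₂ x W ∩ connEvent ends u y = if u ∈ W then fibre ends a₁ a₂ x W else ∅ := by
  ext ω
  constructor
  · rintro ⟨hω, huy⟩
    have hxy : Conn ends ω x y := by
      have : y ∈ cluster ends ω x := by rw [hω.2]; exact Finset.mem_coe.2 hW
      exact this
    have hu' : u ∈ W := by
      have : u ∈ cluster ends ω x := conn_trans hxy (conn_symm huy)
      rw [hω.2] at this
      exact Finset.mem_coe.1 this
    rw [if_pos hu']
    exact hω
  · intro hω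
    by_cases hu : u ∈ W
    · rw [if_pos hu] at hω
      refine ⟨hω, ?_⟩
      have hxu : Conn ends ω x u := by
        have : u ∈ cluster ends ω x := by rw [hω.2]; exact Finset.mem_coe.2 hu
        exact this
      have hxy : Conn ends ω x y := by
        have : y ∈ cluster ends ω x := by rw [hω.2]; exact Finset.mem_coe.2 hW
        exact this
      exact conn_trans (conn_symm hxu) hxy
    · rw [if_neg hu] at hω
      exact absurd hω (Set.notMem_empty ω)

omit [DecidablePred (· ∈ EA)] in
/-- `PD_x` is a `B`-side event when `x` and the roots lie on the `B`-side. -/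
lemma PDEvent_eq_sideEventB (h : IsCut ends y ↑VA ↑VB EA EB) (hx : x ∈ insert y VB)
    (h1 : a₁ ∈ insert y VB) (h2 : a₂ ∈ insert y VB) :
    PDEvent ends a₁ a₂ x = sideEvent EB (PDEvent ends a₁ a₂ x) := by
  ext ω
  simp only [mem_sideEvent, PDEvent, Dtilde, UnionCluster.inU, Set.mem_inter_iff, Set.mem_compl_iff,
    Set.mem_union, mem_connEvent]
  rw [conn_iff_restrict h.symm (mem_coe_union_of_mem_insert h1) (mem_coe_union_of_mem_insert h2),
    conn_iff_restrict h.symm (mem_coe_union_of_mem_insert hx) (mem_coe_union_of_mem_insert h1),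
    conn_iff_restrict h.symm (mem_coe_union_of_mem_insert hx) (mem_coe_union_of_mem_insert h2)]

end Sets

section Masses

variable {V : Type*} {E : Type*} [Fintype V] [DecidableEq V] [Fintype E] [DecidableEq E]
  {R : Type*} [Field R] [LinearOrder R] [IsStrictOrderedRing R] {ends : E → Sym2 V} {y : V}
  {VA VB : Finset V} {EA EB : Set E} [DecidablePred (· ∈ EA)] [DecidablePred (· ∈ EB)] {p : E → R}
  {x a₁ a₂ : V}

omit [Fintype V] [LinearOrder R] [IsStrictOrderedRing R] in
/-- **The pull-back on a `B`-side event**: `P(Y, u ↔ m) = P(Y, u ↔ y) · P(y ↔ m)` for `u ∈ VB ∪ {y}`,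
`m ∈ VA` and `Y` a `B`-side event. -/
lemma prob_inter_conn_pull (h : IsCut ends y ↑VA ↑VB EA EB) {u m : V} (hu : u ∈ insert y VB)
    (hm : m ∈ VA) {Y : Set (Config E)} (hY : Y = sideEvent EB Y) :
    prob p (Y ∩ connEvent ends u m) = prob p (Y ∩ connEvent ends u y) * prob p (connEvent ends y m) := by
  have e1 : Y ∩ connEvent ends u m =
      sideEvent EB (Y ∩ connEvent ends u y) ∩ sideEvent EA (connEvent ends y m) := by
    rw [connEvent_eq_inter_sideEvent h hu hm, ← sideEvent_inter, ← hY,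
      ← connEvent_eq_sideEventB' h hu (Finset.mem_insert_self y VB), Set.inter_assoc]
  have e2 : sideEvent EB (Y ∩ connEvent ends u y) = Y ∩ connEvent ends u y := by
    rw [← sideEvent_inter, ← hY, ← connEvent_eq_sideEventB' h hu (Finset.mem_insert_self y VB)]
  have e3 : sideEvent EA (connEvent ends y m) = connEvent ends y m :=
    (connEvent_eq_sideEvent h (Or.inr rfl) (Or.inl (Finset.mem_coe.2 hm))).symm
  rw [e1, prob_sideEvent_inter_eq_mul p h.symm, e2, e3]

omit [Fintype V] [LinearOrder R] [IsStrictOrderedRing R] in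
/-- `P(Q, m ∈ U) = P(y ↔ m) · P(Q, y ∈ U)` for a mark `m` behind `y`. -/
lemma mU_pull (h : IsCut ends y ↑VA ↑VB EA EB) (h1 : a₁ ∈ insert y VB) (h2 : a₂ ∈ insert y VB)
    {m : V} (hm : m ∈ VA) :
    LeafStep.mU p ends a₁ a₂ m = prob p (connEvent ends y m) * LeafStep.mU p ends a₁ a₂ y := by
  unfold LeafStep.mU
  rw [prob_inter_conn_pull h h1 hm (avoidAll_eq_sideEventB' h h1 h2),
    prob_inter_conn_pull h h2 hm (avoidAll_eq_sideEventB' h h1 h2)]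
  ring

omit [Fintype V] [LinearOrder R] [IsStrictOrderedRing R] in
/-- `D_m = P(y ↔ m) · D_y` for a mark `m` behind `y`. -/
lemma Do_pull (h : IsCut ends y ↑VA ↑VB EA EB) (hx : x ∈ insert y VB) (h1 : a₁ ∈ insert y VB)
    (h2 : a₂ ∈ insert y VB) {m : V} (hm : m ∈ VA) :
    Do p ends m a₁ a₂ x = prob p (connEvent ends y m) * Do p ends y a₁ a₂ x := by
  unfold Do
  rw [prob_inter_conn_pull h h1 hm (PDEvent_eq_sideEventB h hx h1 h2),
    prob_inter_conn_pull h h2 hm (PDEvent_eq_sideEventB h hx h1 h2)]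
  ring

omit [Fintype V] [LinearOrder R] [IsStrictOrderedRing R] in
/-- `γ_m = P(y ↔ m) · γ_y`. -/
lemma gamma_pull (h : IsCut ends y ↑VA ↑VB EA EB) (hx : x ∈ insert y VB) (h1 : a₁ ∈ insert y VB)
    (h2 : a₂ ∈ insert y VB) {m : V} (hm : m ∈ VA) :
    gamma p ends m a₁ a₂ x = prob p (connEvent ends y m) * gamma p ends y a₁ a₂ x := by
  unfold gamma
  rw [Do_pull h hx h1 h2 hm, mul_div_assoc]

omit [Fintype V] [LinearOrder R] [IsStrictOrderedRing R] in
/-- `γ₀_m = P(y ↔ m) · γ₀_y`. -/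
lemma gamma0_pull (h : IsCut ends y ↑VA ↑VB EA EB) (h1 : a₁ ∈ insert y VB) (h2 : a₂ ∈ insert y VB)
    {m : V} (hm : m ∈ VA) :
    gamma0 p ends m a₁ a₂ = prob p (connEvent ends y m) * gamma0 p ends y a₁ a₂ := by
  unfold gamma0
  rw [mU_pull h h1 h2 hm, mul_div_assoc]

omit [Fintype V] [LinearOrder R] [IsStrictOrderedRing R] in
/-- On a fibre `W ∌ y`, `σ_m` has `P(y ↔ m)` times the mass of `σ_y`. -/
lemma Ssig_pull_notMem (h : IsCut ends y ↑VA ↑VB EA EB) (hx : x ∈ insert y VB)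
    (h1 : a₁ ∈ insert y VB) (h2 : a₂ ∈ insert y VB) {m : V} (hm : m ∈ VA) {W : Finset V}
    (hW : y ∉ W) :
    Ssig p ends a₁ a₂ x m W = prob p (connEvent ends y m) * Ssig p ends a₁ a₂ x y W := by
  unfold Ssig
  rw [prob_inter_conn_pull h h1 hm (fibre_eq_sideEventB_of_notMem h hx h1 h2 hW),
    prob_inter_conn_pull h h2 hm (fibre_eq_sideEventB_of_notMem h hx h1 h2 hW)]
  ring

omit [Fintype V] [LinearOrder R] [IsStrictOrderedRing R] in
/-- On a fibre `W ∌ y`, `U_m` has `P(y ↔ m)` times the mass of `U_y`. -/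
lemma Su_pull_notMem (h : IsCut ends y ↑VA ↑VB EA EB) (hx : x ∈ insert y VB)
    (h1 : a₁ ∈ insert y VB) (h2 : a₂ ∈ insert y VB) {m : V} (hm : m ∈ VA) {W : Finset V}
    (hW : y ∉ W) :
    Su p ends a₁ a₂ x m W = prob p (connEvent ends y m) * Su p ends a₁ a₂ x y W := by
  unfold Su
  rw [prob_inter_conn_pull h h1 hm (fibre_eq_sideEventB_of_notMem h hx h1 h2 hW),
    prob_inter_conn_pull h h2 hm (fibre_eq_sideEventB_of_notMem h hx h1 h2 hW)]
  ring

omit [LinearOrder R] [IsStrictOrderedRing R] in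
/-- On a fibre `W ∋ y` of the world `A` (no root in `W`), `U_m` and `U_y` both vanish. -/
lemma Su_pull_mem_fibresA (h : IsCut ends y ↑VA ↑VB EA EB) (h1 : a₁ ∈ insert y VB)
    (h2 : a₂ ∈ insert y VB) {m : V} (hm : m ∈ VA) {W : Finset V} (hW : y ∈ W)
    (hWA : W ∈ fibresA a₁ a₂) :
    Su p ends a₁ a₂ x m W = prob p (connEvent ends y m) * Su p ends a₁ a₂ x y W := by
  have ha1 : a₁ ∉ W := (Finset.mem_filter.1 hWA).2.1
  have ha2 : a₂ ∉ W := (Finset.mem_filter.1 hWA).2.2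
  unfold Su
  rw [fibre_inter_conn_of_mem h h1 hm hW, fibre_inter_conn_of_mem h h2 hm hW,
    fibre_inter_conn_y_of_mem hW a₁, fibre_inter_conn_y_of_mem hW a₂,
    if_neg (show ¬ (a₁ ∈ W ∧ m ∈ W) from fun hc => ha1 hc.1),
    if_neg (show ¬ (a₂ ∈ W ∧ m ∈ W) from fun hc => ha2 hc.1), if_neg ha1, if_neg ha2, prob_empty]
  ring

omit [LinearOrder R] [IsStrictOrderedRing R] in
/-- On every fibre of the world `A`, `U_m = P(y ↔ m) · U_y`. -/
lemma Su_pull_fibresA (h : IsCut ends y ↑VA ↑VB EA EB) (hx : x ∈ insert y VB)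
    (h1 : a₁ ∈ insert y VB) (h2 : a₂ ∈ insert y VB) {m : V} (hm : m ∈ VA) {W : Finset V}
    (hWA : W ∈ fibresA a₁ a₂) :
    Su p ends a₁ a₂ x m W = prob p (connEvent ends y m) * Su p ends a₁ a₂ x y W := by
  by_cases hW : y ∈ W
  · exact Su_pull_mem_fibresA h h1 h2 hm hW hWA
  · exact Su_pull_notMem h hx h1 h2 hm hW

omit [Fintype V] [LinearOrder R] [IsStrictOrderedRing R] in
/-- On a fibre `W ∋ y`, `F⁰_m(P(y ↔ m) γ) = P(y ↔ m) · F⁰_y(γ)`: both are `σ₃ γ m_W` up to the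
factor (the `σ_m`- and `U_m`-parts cancel against `σ₃`). -/
lemma SFg_pull_mem (h : IsCut ends y ↑VA ↑VB EA EB) (h1 : a₁ ∈ insert y VB)
    (h2 : a₂ ∈ insert y VB) {m : V} (hm : m ∈ VA) {W : Finset V} (hW : y ∈ W) (γ : R) :
    RootEdge.SFg p ends m a₁ a₂ x (prob p (connEvent ends y m) * γ) W =
      prob p (connEvent ends y m) * RootEdge.SFg p ends y a₁ a₂ x γ W := by
  unfold RootEdge.SFg Ssig Su s3
  rw [fibre_inter_conn_of_mem h h1 hm hW, fibre_inter_conn_of_mem h h2 hm hW]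
  rw [fibre_inter_conn_y_of_mem hW a₁]
  rw [fibre_inter_conn_y_of_mem hW a₂]
  by_cases ha1 : a₁ ∈ W <;> by_cases ha2 : a₂ ∈ W <;> by_cases hm' : m ∈ W <;>
    simp only [ha1, ha2, hm', and_self, and_true, and_false, ↓reduceIte, prob_empty]
  all_goals first
    | (rw [fibre_eq_empty_of_mem_mem ends a₁ a₂ x ha1 ha2]; simp only [prob_empty]; ring)
    | ring

omit [Fintype V] [LinearOrder R] [IsStrictOrderedRing R] in
/-- On a fibre `W ∌ y`, `F⁰_m(P(y ↔ m) γ) = P(y ↔ m) · F⁰_y(γ)` termwise. -/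
lemma SFg_pull_notMem (h : IsCut ends y ↑VA ↑VB EA EB) (hx : x ∈ insert y VB)
    (h1 : a₁ ∈ insert y VB) (h2 : a₂ ∈ insert y VB) {m : V} (hm : m ∈ VA) {W : Finset V}
    (hW : y ∉ W) (γ : R) :
    RootEdge.SFg p ends m a₁ a₂ x (prob p (connEvent ends y m) * γ) W =
      prob p (connEvent ends y m) * RootEdge.SFg p ends y a₁ a₂ x γ W := by
  unfold RootEdge.SFg
  rw [Ssig_pull_notMem h hx h1 h2 hm hW, Su_pull_notMem h hx h1 h2 hm hW]
  ring

omit [Fintype V] [LinearOrder R] [IsStrictOrderedRing R] in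
/-- **The mark pulls back to the cut vertex on every fibre**:
`F⁰_m(P(y ↔ m) γ) = P(y ↔ m) · F⁰_y(γ)`. -/
lemma SFg_pull (h : IsCut ends y ↑VA ↑VB EA EB) (hx : x ∈ insert y VB) (h1 : a₁ ∈ insert y VB)
    (h2 : a₂ ∈ insert y VB) {m : V} (hm : m ∈ VA) (γ : R) (W : Finset V) :
    RootEdge.SFg p ends m a₁ a₂ x (prob p (connEvent ends y m) * γ) W =
      prob p (connEvent ends y m) * RootEdge.SFg p ends y a₁ a₂ x γ W := by
  by_cases hW : y ∈ W
  · exact SFg_pull_mem h h1 h2 hm hW γ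
  · exact SFg_pull_notMem h hx h1 h2 hm hW γ

end Masses

end MarkPull

end A3Fibre

end CovForm

end Summit.Ventures.PercRepro2
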